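import Mathlib
import Summits.ValiantsHypothesis.ValiantsHypothesis.Theorems.KPlusLogSqLawWeakLiftingTowerGraftFoldLawAxisPair

/-!
# Tower graft line — THE PRINCIPAL-MINOR EXPANSION OF A DIAGONAL GRAFT: the top digit (event (Er)) is a class determinant, any rank, any signature

Mechanism file for the line `Cruxes/WeakLifting/Lines/tower_graft.lean` (crux `WeakLifting` = stmt-ValiantsHypothesis-19561), memo §1 (Er) «real
zeros of `E_r` = ± det of the compression of `G` … paid by the budget `B`»: in the kernel for EVERY DIAGONAL far letter `Σ_{k∈A} sₖEₖₖ` (any rank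
`#A`, any signs), extending p709692's rank-two digits.  NO stub is claimed.

* `det_unitRows_eq_submatrix` — rows in `J` replaced by unit rows ⇒ the principal minor off `J`;
  `updateRow_add_sum_smul_single`, `unitRows_updateRow`, `unitRows_map` — bookkeeping.
* ★ `det_add_sum_smul_single` — **PRINCIPAL-MINOR EXPANSION** (any commutative ring, any finite index type):
  `det(M + Σ_{k∈A} cₖEₖₖ) = Σ_{J⊆A} (∏_{k∈J} cₖ)·det M[Jᶜ]` (induction on `A` with p709692's one-corner lemma `det_add_smul_single_eq_adjugate`).
* ★ `coeff_card_det_map_add_X_smul_diagonal` — for `Q(Y) = det(M + Y·Σ_{k∈A} sₖEₖₖ)`: `[Y^{#A}] Q = (∏ sₖ)·det M[Aᶜ]` and `[Y^N] Q = 0` for `N > #A`.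
* ★ `card_posRoots_topDigit_le` — for a symmetric lacunary pencil `G` of size `m`: `det G[Aᶜ]` is the determinant of a symmetric pencil of size `m − #A`
  on the SAME support, so `Z₊(det G[Aᶜ]) ≤ B` under `PosRootLawOn (m − #A) K B d` — the event (Er) of the graft `det(G + X^D·Σ sₖEₖₖ)` (branches
  escaping to `T = ∞`) is class-paid for every diagonal far letter; by congruence (`…FoldLawRankTwo`'s pattern) for every far letter.

READING: with (E0) = `det G` and (Er) now class-paid at every rank, the rank-dependence of T3 sits entirely in the folds (Ed): product of two class
determinants at rank two (p709692/p710589), open for mixed signature at rank ≥ 3 (memo §18).  HONEST FRAMING: exact linear algebra; nothing on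
S4/S4b/S5/S5ᴸ, TowerB, `WeakLifting`, Conjecture B, `MatrixDescartes` (18050) or `VP ≠ VNP`.  Def-free.  Seat: prover val-sym-lift-p2 g21,
`--supports stmt-ValiantsHypothesis-19561`.
-/

-- `Summit.ValiantsHypothesis.ValiantsHypothesis.…` repeats a component by the D-0017 layout
-- (single-conjunct summit), which the `dupNamespace` linter flags; the name is mandated.
set_option linter.dupNamespace false

namespace Summit.ValiantsHypothesis.ValiantsHypothesis.Theorems.KPlusLogSqLaw.TowerGraft

open Polynomial Matrix
open scoped BigOperators Polynomial

section DiagonalDigits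

variable {n : Type*} [Fintype n] [DecidableEq n] {R : Type*} [CommRing R]

/-- replacing the rows indexed by `J` with unit rows leaves the principal minor off `J`. [folklore] -/
theorem det_unitRows_eq_submatrix (M : Matrix n n R) (J : Finset n) :
    (Matrix.of fun i j => if i ∈ J then (Pi.single i (1 : R) : n → R) j else M i j).det =
      (M.submatrix (Subtype.val : {a // a ∉ J} → n) Subtype.val).det := by
  set N : Matrix n n R := Matrix.of fun i j => if i ∈ J then (Pi.single i (1 : R) : n → R) j else M i j with hN
  rw [Matrix.twoBlockTriangular_det N (fun a => a ∉ J)]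
  · have h1 : N.toSquareBlockProp (fun a => a ∉ J) = M.submatrix (Subtype.val : {a // a ∉ J} → n) Subtype.val := by
      ext ⟨a, ha⟩ ⟨b, hb⟩
      simp [Matrix.toSquareBlockProp_def, hN, ha]
    have h2 : N.toSquareBlockProp (fun a => ¬(a ∉ J)) = 1 := by
      ext ⟨a, ha⟩ ⟨b, hb⟩
      have ha' : a ∈ J := by simpa using ha
      simp [Matrix.toSquareBlockProp_def, hN, ha', Matrix.one_apply, Pi.single_apply, eq_comm]
    rw [h1, h2, Matrix.det_one, mul_one]
  · intro r hr a ha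
    have hr' : r ∈ J := by simpa using hr
    have hne : a ≠ r := fun h => ha (h ▸ hr')
    simp [hN, hr', Pi.single_apply, hne]

omit [Fintype n] in
/-- updating a row outside `A` commutes with adding corners on `A`. [folklore] -/
theorem updateRow_add_sum_smul_single (M : Matrix n n R) (A : Finset n) (c : n → R) {a : n} (ha : a ∉ A) (v : n → R) :
    (M + ∑ k ∈ A, c k • Matrix.single k k (1 : R)).updateRow a v = M.updateRow a v + ∑ k ∈ A, c k • Matrix.single k k (1 : R) := by
  ext x y
  rcases eq_or_ne x a with rfl | hx
  · simp only [Matrix.updateRow_self, Matrix.add_apply, Matrix.sum_apply, Matrix.smul_apply, Matrix.single_apply, smul_eq_mul]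
    rw [Finset.sum_eq_zero]
    · simp
    · intro k hk
      have : k ≠ x := fun h => ha (h ▸ hk)
      simp [this]
  · simp [Matrix.updateRow_ne hx]

omit [Fintype n] in
/-- the unit-row matrix of `M.updateRow a eₐ` on `J` is the unit-row matrix of `M` on `insert a J`. [folklore] -/
theorem unitRows_updateRow (M : Matrix n n R) (J : Finset n) (a : n) :
    (Matrix.of fun i j => if i ∈ J then (Pi.single i (1 : R) : n → R) j else (M.updateRow a (Pi.single a (1 : R))) i j) =
      Matrix.of fun i j => if i ∈ insert a J then (Pi.single i (1 : R) : n → R) j else M i j := by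
  ext i j
  simp only [Matrix.of_apply, Finset.mem_insert, Matrix.updateRow_apply]
  by_cases hi : i ∈ J
  · simp [hi]
  · by_cases hia : i = a
    · subst hia; simp [hi]
    · simp [hi, hia]

/-- **PRINCIPAL-MINOR EXPANSION OF A DIAGONAL PERTURBATION**: `det(M + Σ_{k∈A} cₖ·Eₖₖ) = Σ_{J⊆A} (∏_{k∈J} cₖ) · det M[Jᶜ]` (the minor written as
the determinant of `M` with the rows in `J` replaced by unit rows, cf. `det_unitRows_eq_submatrix`). [folklore] -/
theorem det_add_sum_smul_single (M : Matrix n n R) (A : Finset n) (c : n → R) :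
    (M + ∑ k ∈ A, c k • Matrix.single k k (1 : R)).det =
      ∑ J ∈ A.powerset, (∏ k ∈ J, c k) * (Matrix.of fun i j => if i ∈ J then (Pi.single i (1 : R) : n → R) j else M i j).det := by
  induction A using Finset.induction_on generalizing M with
  | empty =>
    simp only [Finset.sum_empty, add_zero, Finset.powerset_empty, Finset.sum_singleton, Finset.prod_empty, one_mul,
      Finset.notMem_empty, if_false]
    rfl
  | insert a A ha ih =>
    rw [Finset.sum_insert ha, ← add_assoc, add_right_comm, det_add_smul_single_eq_adjugate, Matrix.adjugate_apply,
      updateRow_add_sum_smul_single M A c ha, ih, ih, Finset.sum_powerset_insert ha]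
    congr 1
    rw [Finset.mul_sum]
    refine Finset.sum_congr rfl fun J hJ => ?_
    have haJ : a ∉ J := fun h => ha (Finset.mem_powerset.mp hJ h)
    rw [Finset.prod_insert haJ, unitRows_updateRow]
    ring

omit [Fintype n] in
/-- the unit-row construction commutes with an entrywise ring map. [folklore] -/
theorem unitRows_map {B : Type*} [CommRing B] (f : R →+* B) (M : Matrix n n R) (J : Finset n) :
    (Matrix.of fun i j => if i ∈ J then (Pi.single i (1 : B) : n → B) j else (M.map f) i j) =
      (Matrix.of fun i j => if i ∈ J then (Pi.single i (1 : R) : n → R) j else M i j).map f := by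
  ext i j
  simp only [Matrix.of_apply, Matrix.map_apply, Pi.single_apply]
  split_ifs <;> simp

/-- **THE TOP DIGIT OF A DIAGONAL GRAFT IS A PRINCIPAL MINOR.**  For the graft polynomial in an indeterminate
`Q(Y) = det(M + Y·Σ_{k∈A} sₖEₖₖ)`, the coefficient of `Y^{#A}` is `(∏_{k∈A} sₖ)·det M[Aᶜ]`, and no higher power occurs. [this work] -/
theorem coeff_card_det_map_add_X_smul_diagonal (M : Matrix n n R) (A : Finset n) (s : n → R) :
    (M.map (C : R →+* R[X]) + (X : R[X]) • ∑ k ∈ A, C (s k) • Matrix.single k k (1 : R[X])).det.coeff A.card =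
      (∏ k ∈ A, s k) * (Matrix.of fun i j => if i ∈ A then (Pi.single i (1 : R) : n → R) j else M i j).det ∧
    ∀ N, A.card < N → (M.map (C : R →+* R[X]) + (X : R[X]) • ∑ k ∈ A, C (s k) • Matrix.single k k (1 : R[X])).det.coeff N = 0 := by
  classical
  have hexp : (M.map (C : R →+* R[X]) + (X : R[X]) • ∑ k ∈ A, C (s k) • Matrix.single k k (1 : R[X])).det =
      ∑ J ∈ A.powerset, X ^ J.card * C ((∏ k ∈ J, s k) *
        (Matrix.of fun i j => if i ∈ J then (Pi.single i (1 : R) : n → R) j else M i j).det) := by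
    rw [Finset.smul_sum]
    simp_rw [smul_smul]
    rw [det_add_sum_smul_single]
    refine Finset.sum_congr rfl fun J _ => ?_
    rw [Finset.prod_mul_distrib, Finset.prod_const, unitRows_map, ← RingHom.mapMatrix_apply, ← RingHom.map_det, map_mul, map_prod]
    ring
  rw [hexp]
  constructor
  · rw [finsetSum_coeff]
    simp only [coeff_X_pow_mul', coeff_C]
    rw [Finset.sum_eq_single A]
    · simp
    · intro J hJ hJA
      have hsub : J ⊆ A := Finset.mem_powerset.mp hJ
      have hlt : J.card < A.card := lt_of_le_of_ne (Finset.card_le_card hsub) (fun h => hJA (Finset.eq_of_subset_of_card_le hsub h.ge))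
      simp [hlt.le, Nat.sub_ne_zero_of_lt hlt]
    · intro h; exact absurd (Finset.mem_powerset_self A) h
  · intro N hN
    rw [finsetSum_coeff]
    refine Finset.sum_eq_zero fun J hJ => ?_
    have hsub : J ⊆ A := Finset.mem_powerset.mp hJ
    have hlt : J.card < N := lt_of_le_of_lt (Finset.card_le_card hsub) hN
    rw [coeff_X_pow_mul', if_pos hlt.le, coeff_C, if_neg (Nat.sub_ne_zero_of_lt hlt)]

end DiagonalDigits

/-! ## (Er) for every diagonal far letter of a lacunary symmetric pencil -/

section DiagonalEscape

open Summit.ValiantsHypothesis.ValiantsHypothesis.Theorems.LacunarySymmetroidMatrixDescartes (PosRootLawOn)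

/-- **(Er) IS CLASS-PAID FOR EVERY DIAGONAL FAR LETTER, ANY RANK, ANY SIGNATURE.**  For the symmetric pencil `G = Σ X^{dₗ} Sₗ` of size `m` and
the far letter `Σ_{k∈A} sₖ Eₖₖ`, the top digit of `det(G + T·Σ sₖEₖₖ)` is `(∏ sₖ)·det G[Aᶜ]` (`coeff_card_det_map_add_X_smul_diagonal`), and
`det G[Aᶜ]` — the determinant of a symmetric pencil of size `m − #A` on the SAME support — has at most `B` positive roots under
`PosRootLawOn (m − #A) K B d`: the event (Er) (branches escaping to `T = ∞`, memo §1) is paid by the class budget of the compression. [this work] -/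
theorem card_posRoots_topDigit_le {m K B : ℕ} (d : Fin K → ℕ) (A : Finset (Fin m)) (hB : PosRootLawOn (m - A.card) K B d)
    (S : Fin K → Matrix (Fin m) (Fin m) ℝ) (hS : ∀ l, (S l).IsSymm) :
    ((Matrix.of fun i j => if i ∈ A then (Pi.single i (1 : ℝ[X]) : Fin m → ℝ[X]) j else
        (∑ l, (X : ℝ[X]) ^ d l • (S l).map C) i j).det.roots.toFinset.filter (fun t => 0 < t)).card ≤ B := by
  classical
  rw [det_unitRows_eq_submatrix]
  have hcard : Fintype.card {a : Fin m // a ∉ A} = m - A.card := by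
    rw [Fintype.card_subtype_compl, Fintype.card_fin, Fintype.card_coe]
  set e := Fintype.equivFinOfCardEq hcard with he
  rw [← Matrix.det_submatrix_equiv_self e.symm, Matrix.submatrix_submatrix, submatrix_pencil']
  exact hB (fun l => (S l).submatrix (Subtype.val ∘ e.symm) (Subtype.val ∘ e.symm)) fun l => (hS l).submatrix _

end DiagonalEscape

end Summit.ValiantsHypothesis.ValiantsHypothesis.Theorems.KPlusLogSqLaw.TowerGraft
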